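import Summits.NavierStokesRegularity.NavierStokesRegularity.Theses.AxisymmetricExtremality
import Literature.Analysis.FluidPDE.RusinSverakSingularPointsStableHolds
import Literature.Analysis.FluidPDE.RusinSverakLerayExistenceHolds
import Literature.Analysis.FluidPDE.RusinSverakLerayAeEqKatoHolds
import Literature.Analysis.FluidPDE.RusinSverakKatoBoundHolds
import Literature.Analysis.FluidPDE.RusinSverakWeakStabilityProofs
import HarnessLib

/-!
# Route AxisymmetricExtremality — crux `MinimalDatumPFold` (stmt-NavierStokesRegularity-15452), stub `stub_concentrationWeakLimitBlowup`

Registered stub of the line `Sketch` (`Cruxes/MinimalDatumPFold/Lines/Sketch.lean`, lead c2):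
the CONCENTRATION analogue of the tree's `rusin_sverak_weak_limit_blowup` (Rusin–Šverák 2011,
Cor. 4.2 and sentence 2 of the proof of Cor. 4.3). GIVEN the quantitative Lemma 2.1
(`stub_uniformRegularity`, taken verbatim as the hypothesis): for `ν > 0`, weakly divergence-free
`L³` data `U k` represented by `Ḣ^{1/2}`-bounded classes `G k`, with Kato-class mild solutions
`u k` on `[0, 1)` which CONCENTRATE at `(1, x k)` (the essential suprema of `|u k|` on every
backward cylinder `Q_r(1, x k)` tend to `∞`), the modulation `lam k = √ν`, `x₀ k = -x k` has the
property that every weak `Ḣ^{1/2}`-limit of a subsequence of the classes of the modulated data is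
represented by an `L³`, weakly divergence-free datum WITHOUT a global Kato solution.
Target tree file:
`Summits/NavierStokesRegularity/NavierStokesRegularity/Theorems/AxisymmetricExtremalityMinimalDatumPFoldConcentrationWeakLimitBlowup.lean`.

Proof summary.

* `concentrationWeakLimit_not_hasGlobalKatoSolution_one` — the core at UNIT viscosity with the
  concentration point already at `(1, 0)`: Leray solutions `w k ∈ NS(V k)` exist (**E**,
  `leray_solution_exists_of_memLp_three_holds`) and agree with the Kato solutions below `t = 1`
  (**W**, `leray_solution_ae_eq_kato_holds`), so they concentrate at `(1, 0)` too; **K**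
  (`rusin_sverak_leray_weak_stability_holds`) puts a subsequence and a Leray solution `ulim` of the
  limit datum in the situation of Prop. 2.2 on `(0, ∞) × ℝ³`; a global Kato solution of the limit
  datum would bound `ulim` on `Q_{√(1/2)}(1, 0)` (**W**, **R** `kato_solution_le_div_sqrt_holds`,
  `eLpNorm_parabolicCylinder_lt_top_of_sqrt_bound`), making `(1, 0)` regular (**B**
  `isRegularPoint_of_eLpNorm_parabolicCylinder_lt_top_holds`), and the hypothesis (uniform
  regularity) would bound the approximants on `Q*_ρ(1, 0) ⊇ Q_{min ρ 1}(1, 0)` eventually —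
  contradicting concentration.
* the stub — reduction to the core: viscosity `ν ↦ 1` by `u ↦ ν⁻¹ u(ν⁻¹ t, ·)`
  (`IsMildNSSolutionOn.timeRescale`, `concentrationWeakLimit_kato_timeRescale`), then the parabolic
  normalisation `(ν, x k) ↦ (1, 0)` with `λ = √ν`, `x₀ = -x k` (`kato_local_rescale_translate`,
  `concentrationWeakLimit_kato_normalise`); concentration is transported by
  `eLpNorm_top_uncurry_rescale_translate` and `eLpNorm_top_comp_stAffine_restrict_preimage`
  (`concentrationWeakLimit_eLpNorm_normalise_ge`); the classes scale by `represents_complexify_smul`,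
  the weak limit is an `L³` real divergence-free datum (`HomSobolev.exists_represents_memLp_three`,
  `HomSobolev.Represents.exists_real_divFree`), and `hasGlobalKatoSolution_smul_iff` returns to `ν`.

References: W. Rusin, V. Šverák, J. Funct. Anal. 260 (2011) 879–891 = arXiv:0911.0500, Cor. 4.2 and
proof of Cor. 4.3 (p. 8) [RusinSverak2011].
-/

set_option linter.dupNamespace false

noncomputable section

open MeasureTheory TopologicalSpace Set Function Filter Topology Metric
open scoped ENNReal NNReal InnerProductSpace

namespace Summit.NavierStokesRegularity.NavierStokesRegularity.Theorems

open Literature.Analysis.FluidPDE Literature.Analysis.FunctionSpaces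
open Literature.Analysis.FunctionSpaces.EuclideanSpace (complexify)

/-! ## Glue on backward cylinders and rescalings -/

/-- Two fields agreeing a.e. on the strip `(0, 1) × ℝ³` have the same essential supremum on every
backward cylinder `Q_r(1, x)` with `r² ≤ 1` (it lies in the strip). [folklore] -/
theorem concentrationWeakLimit_eLpNorm_congr_strip
    {u v : ℝ → EuclideanSpace ℝ (Fin 3) → EuclideanSpace ℝ (Fin 3)}
    (hae : uncurry u =ᵐ[volume.restrict (Ioo 0 1 ×ˢ (univ : Set (EuclideanSpace ℝ (Fin 3))))]
      uncurry v)
    {r : ℝ} (hr : r ^ 2 ≤ 1) (x : EuclideanSpace ℝ (Fin 3)) :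
    eLpNorm (uncurry u) ∞ (volume.restrict (parabolicCylinder r ((1 : ℝ), x))) =
      eLpNorm (uncurry v) ∞ (volume.restrict (parabolicCylinder r ((1 : ℝ), x))) :=
  eLpNorm_congr_ae
    (ae_restrict_of_ae_restrict_of_subset (parabolicCylinder_subset_strip hr le_rfl x) hae)

/-- **Viscosity normalisation of a local Kato solution**: if `u` is a Kato-class mild solution on
`[0, 1)` with viscosity `ν > 0` and datum `U`, then `ν⁻¹ u(ν⁻¹ ·)` is a Kato solution on `[0, ν)`
with unit viscosity and datum `ν⁻¹ U` (`IsMildNSSolutionOn.timeRescale`,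
`ContinuousInLpOn.timeRescale`, `aestronglyMeasurable_comp_stAffine_Ioo`).
[cite: RusinSverak2011, §1 (arXiv:0911.0500 p. 3, unit viscosity)] -/
theorem concentrationWeakLimit_kato_timeRescale {ν : ℝ} (hν : 0 < ν)
    {U : EuclideanSpace ℝ (Fin 3) → EuclideanSpace ℝ (Fin 3)}
    {u : ℝ → EuclideanSpace ℝ (Fin 3) → EuclideanSpace ℝ (Fin 3)}
    (h : IsMildNSSolutionOn (Ico 0 1) ν 0 U u ∧ ContinuousInLpOn (Ico 0 1) 3 u ∧ u 0 = U ∧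
      AEStronglyMeasurable (uncurry u)
        (volume.restrict (Ioo 0 1 ×ˢ (univ : Set (EuclideanSpace ℝ (Fin 3)))))) :
    IsKatoSolutionOn ν 1 (ν⁻¹ • U) (timeRescale ν⁻¹ ν⁻¹ u) := by
  have ha : 0 < ν⁻¹ := inv_pos.2 hν
  have hS : MapsTo (fun t => ν⁻¹ * t) (Ico 0 ν) (Ico 0 1) := fun t ht => by
    refine ⟨mul_nonneg ha.le ht.1, ?_⟩
    calc ν⁻¹ * t < ν⁻¹ * ν := mul_lt_mul_of_pos_left ht.2 ha
      _ = 1 := inv_mul_cancel₀ hν.ne'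
  refine ⟨?_, h.2.1.timeRescale ν⁻¹ hS, ?_, ?_⟩
  · have h1 := IsMildNSSolutionOn.timeRescale ha h.1 hS
    rwa [timeRescale_zero_force, inv_mul_cancel₀ hν.ne'] at h1
  · funext y
    simp [timeRescale_apply, h.2.2.1]
  · have hm := aestronglyMeasurable_comp_stAffine_Ioo ha one_pos (0 : EuclideanSpace ℝ (Fin 3))
      (T := 1) h.2.2.2
    rw [one_div, inv_inv] at hm
    have h2 : uncurry (timeRescale ν⁻¹ ν⁻¹ u) =
        fun z => ν⁻¹ • (uncurry u ∘ stAffine ν⁻¹ 1 0 (0 : EuclideanSpace ℝ (Fin 3))) z := by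
      funext ⟨s, y⟩
      simp [timeRescale_apply, stAffine]
    rw [h2]
    exact hm.const_smul ν⁻¹

/-- **Full normalisation of a concentrating Kato solution**: viscosity `ν ↦ 1` by
`u ↦ ν⁻¹ u(ν⁻¹ ·)`, then the parabolic dilation `λ = √ν` and the translation `x₀ = -x`
(`kato_local_rescale_translate`): the field `(t, y) ↦ √ν ν⁻¹ u(t, √ν y + x)` is a Kato solution on
`[0, 1)` with unit viscosity and datum `ν⁻¹ • (y ↦ √ν U(√ν y + x))`.
[cite: RusinSverak2011, §1 (arXiv:0911.0500 p. 3) and proof of Cor. 4.3 (p. 8)] -/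
theorem concentrationWeakLimit_kato_normalise {ν : ℝ} (hν : 0 < ν)
    {U : EuclideanSpace ℝ (Fin 3) → EuclideanSpace ℝ (Fin 3)}
    {u : ℝ → EuclideanSpace ℝ (Fin 3) → EuclideanSpace ℝ (Fin 3)}
    (h : IsMildNSSolutionOn (Ico 0 1) ν 0 U u ∧ ContinuousInLpOn (Ico 0 1) 3 u ∧ u 0 = U ∧
      AEStronglyMeasurable (uncurry u)
        (volume.restrict (Ioo 0 1 ×ˢ (univ : Set (EuclideanSpace ℝ (Fin 3))))))
    (x : EuclideanSpace ℝ (Fin 3)) :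
    IsKatoSolutionOn 1 1 (ν⁻¹ • rescaleData (Real.sqrt ν) (fun y => U (y - -x)))
      (fun t y => Real.sqrt ν •
        timeRescale ν⁻¹ ν⁻¹ u (Real.sqrt ν ^ 2 * t) (Real.sqrt ν • y - -x)) := by
  have hc : 0 < Real.sqrt ν := Real.sqrt_pos.2 hν
  have hν1 : ν / Real.sqrt ν ^ 2 = 1 := by rw [Real.sq_sqrt hν.le, div_self hν.ne']
  have hK := concentrationWeakLimit_kato_timeRescale hν h
  obtain ⟨k1, k2, k3, k4⟩ := kato_local_rescale_translate hK.mild hK.continuousInLpOn hK.initial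
    hK.aestronglyMeasurable hc (-x)
  rw [hν1] at k1 k2 k4
  have hdat : rescaleData (Real.sqrt ν) (fun y => (ν⁻¹ • U) (y - -x)) =
      ν⁻¹ • rescaleData (Real.sqrt ν) (fun y => U (y - -x)) := by
    funext y
    simp only [rescaleData, Pi.smul_apply]
    rw [smul_comm]
  rw [hdat] at k1 k3
  exact ⟨k1, k2, k3, k4⟩

/-- Essential suprema under the time rescaling `u ↦ a u(a ·)` (`a > 0`): if the pull-back of `S`
under `(s, y) ↦ (a s, y)` lies in `S'`, then `a · ess sup_S |u| ≤ ess sup_{S'} |a u(a ·)|`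
(`eLpNorm_top_comp_stAffine_restrict_preimage` and monotonicity in the set). [folklore] -/
theorem concentrationWeakLimit_eLpNorm_timeRescale_ge {a : ℝ} (ha : 0 < a)
    (u : ℝ → EuclideanSpace ℝ (Fin 3) → EuclideanSpace ℝ (Fin 3))
    {S S' : Set (ℝ × EuclideanSpace ℝ (Fin 3))}
    (hSS' : stAffine a 1 0 (0 : EuclideanSpace ℝ (Fin 3)) ⁻¹' S ⊆ S') :
    ‖a‖ₑ * eLpNorm (uncurry u) ∞ (volume.restrict S) ≤
      eLpNorm (uncurry (timeRescale a a u)) ∞ (volume.restrict S') := by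
  have h2 : uncurry (timeRescale a a u) =
      a • (uncurry u ∘ stAffine a 1 0 (0 : EuclideanSpace ℝ (Fin 3))) := by
    funext ⟨s, y⟩
    simp [timeRescale_apply, stAffine]
  rw [h2, eLpNorm_const_smul, ← eLpNorm_top_comp_stAffine_restrict_preimage ha one_pos 0
    (0 : EuclideanSpace ℝ (Fin 3)) (uncurry u) S]
  exact mul_le_mul_right (eLpNorm_mono_measure _ (Measure.restrict_mono hSS' le_rfl)) _

/-- The pull-back of the backward cylinder `Q_{r'}(1, x)` under `(s, y) ↦ (ν⁻¹ s, y)` lies in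
`Q_{√ν r}(ν, x)` as soon as `0 ≤ r' ≤ min (r, √ν r)`. [folklore] -/
theorem concentrationWeakLimit_preimage_subset {ν : ℝ} (hν : 0 < ν) (x : EuclideanSpace ℝ (Fin 3))
    {r r' : ℝ} (h1 : r' ≤ Real.sqrt ν * r) (h2 : r' ≤ r) (hr' : 0 ≤ r') :
    stAffine ν⁻¹ 1 0 (0 : EuclideanSpace ℝ (Fin 3)) ⁻¹' parabolicCylinder r' ((1 : ℝ), x) ⊆
      parabolicCylinder (Real.sqrt ν * r) ((ν : ℝ), x) := by
  rintro ⟨s, y⟩ hz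
  simp only [mem_preimage, stAffine_apply, zero_add, one_smul, mem_parabolicCylinder] at hz
  rw [mem_parabolicCylinder]
  obtain ⟨⟨hs1, hs2⟩, hy⟩ := hz
  have e1 : (Real.sqrt ν * r) ^ 2 = ν * r ^ 2 := by rw [mul_pow, Real.sq_sqrt hν.le]
  have e2 : ν * r' ^ 2 ≤ ν * r ^ 2 := mul_le_mul_of_nonneg_left (pow_le_pow_left₀ hr' h2 2) hν.le
  have e3 : ν * (1 - r' ^ 2) < s := by
    have := mul_lt_mul_of_pos_left hs1 hν
    rwa [← mul_assoc, mul_inv_cancel₀ hν.ne', one_mul] at this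
  have e4 : s < ν := by
    have := mul_lt_mul_of_pos_left hs2 hν
    rwa [← mul_assoc, mul_inv_cancel₀ hν.ne', one_mul, mul_one] at this
  refine ⟨⟨?_, e4⟩, hy.trans_le h1⟩
  rw [e1]
  nlinarith

/-- **Concentration is transported by the normalisation.** For `ν > 0`, `r > 0` and
`r' = min r (√ν r)`:
`√ν · ν⁻¹ · ess sup_{Q_{r'}(1, x)} |u| ≤ ess sup_{Q_r(1, 0)} |v|` for the normalised field
`v(t, y) = √ν · (ν⁻¹ u(ν⁻¹ ·))(√ν² t, √ν y + x)` (`eLpNorm_top_uncurry_rescale_translate`, then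
`concentrationWeakLimit_eLpNorm_timeRescale_ge` on `Q_{r'}(1, x)`, whose pull-back lies in
`Q_{√ν r}(ν, x)`). [cite: RusinSverak2011, proof of Cor. 4.3 (arXiv:0911.0500 p. 8) with §1 (p. 3)] -/
theorem concentrationWeakLimit_eLpNorm_normalise_ge {ν : ℝ} (hν : 0 < ν)
    (u : ℝ → EuclideanSpace ℝ (Fin 3) → EuclideanSpace ℝ (Fin 3)) (x : EuclideanSpace ℝ (Fin 3))
    {r : ℝ} (hr : 0 < r) :
    ‖Real.sqrt ν‖ₑ * ‖ν⁻¹‖ₑ * eLpNorm (uncurry u) ∞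
        (volume.restrict (parabolicCylinder (min r (Real.sqrt ν * r)) ((1 : ℝ), x))) ≤
      eLpNorm (uncurry fun t y => Real.sqrt ν •
          timeRescale ν⁻¹ ν⁻¹ u (Real.sqrt ν ^ 2 * t) (Real.sqrt ν • y - -x)) ∞
        (volume.restrict (parabolicCylinder r ((1 : ℝ), (0 : EuclideanSpace ℝ (Fin 3))))) := by
  have hc : 0 < Real.sqrt ν := Real.sqrt_pos.2 hν
  rw [eLpNorm_top_uncurry_rescale_translate (timeRescale ν⁻¹ ν⁻¹ u) hc (-x) r 1 0, smul_zero,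
    zero_sub, neg_neg, mul_one, Real.sq_sqrt hν.le, mul_assoc]
  exact mul_le_mul_right (concentrationWeakLimit_eLpNorm_timeRescale_ge (inv_pos.2 hν) u
    (concentrationWeakLimit_preimage_subset hν x (min_le_right _ _) (min_le_left _ _)
      (le_min hr.le (mul_nonneg hc.le hr.le)))) _

/-! ## The core at unit viscosity -/

/-- **Weak limits of concentrating sequences blow up — unit viscosity, concentration at `(1, 0)`**
(Rusin–Šverák 2011, Cor. 4.2 with the quantitative Lemma 2.1). GIVEN uniform regularity near
regular points of the limit in the situation of Prop. 2.2 (the hypothesis `hUR`, = the statement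
of `stub_uniformRegularity`): if `V k` are weakly divergence-free `L³` data represented by classes
`g k` with `‖g k‖ ≤ R`, `v k` are unit-viscosity Kato solutions on `[0, 1)` with data `V k` whose
essential suprema on every `Q_r(1, 0)` tend to `∞`, and `g k ⇀ glim` weakly, then no weakly
divergence-free `L³` field `vlim` represented by `glim` has a global Kato solution. Proof: **E**,
**W** (the Leray solutions `w k ∈ NS(V k)` concentrate too), **K** (a subsequence and
`(ulim, plim) ∈ NS(vlim)` in the situation of Prop. 2.2), then a global Kato solution of `vlim`
bounds `ulim` on `Q_{√(1/2)}(1, 0)` (**W**, **R**), so `(1, 0)` is regular (**B**) and `hUR`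
bounds the `w k` uniformly on `Q_{min ρ 1}(1, 0)` eventually — against concentration.
[cite: RusinSverak2011, Cor. 4.2 and proof of Cor. 4.3 (arXiv:0911.0500 p. 8)] -/
theorem concentrationWeakLimit_not_hasGlobalKatoSolution_one
    (hUR : ∀ (O : TopologicalSpace.Opens (ℝ × EuclideanSpace ℝ (Fin 3)))
      (useq : ℕ → ℝ → EuclideanSpace ℝ (Fin 3) → EuclideanSpace ℝ (Fin 3))
      (pseq : ℕ → ℝ → EuclideanSpace ℝ (Fin 3) → ℝ)
      (u : ℝ → EuclideanSpace ℝ (Fin 3) → EuclideanSpace ℝ (Fin 3))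
      (p : ℝ → EuclideanSpace ℝ (Fin 3) → ℝ),
      RusinSverak2011.CompactnessSituation O useq pseq u p →
      ∀ z₀ : ℝ × EuclideanSpace ℝ (Fin 3), z₀ ∈ O → IsRegularPoint u z₀ →
      ∃ ρ : ℝ, 0 < ρ ∧ ∃ B : ℝ≥0, ∀ᶠ k : ℕ in atTop,
        eLpNorm (uncurry (useq k)) ⊤ (volume.restrict (parabolicCylinderCentered ρ z₀)) ≤ (B : ℝ≥0∞))
    {V : ℕ → EuclideanSpace ℝ (Fin 3) → EuclideanSpace ℝ (Fin 3)}
    {g : ℕ → HomSobolev (EuclideanSpace ℝ (Fin 3)) (EuclideanSpace ℂ (Fin 3)) (1 / 2 : ℝ)}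
    {v : ℕ → ℝ → EuclideanSpace ℝ (Fin 3) → EuclideanSpace ℝ (Fin 3)}
    (hV : ∀ k, MemLp (V k) 3 volume ∧ (g k).Represents (complexify ∘ V k) ∧ IsWeaklyDivFree (V k))
    (hbdd : ∃ R : ℝ, ∀ k, ‖g k‖ ≤ R) (hv : ∀ k, IsKatoSolutionOn 1 1 (V k) (v k))
    (hconc : ∀ r : ℝ, 0 < r → Tendsto (fun k => eLpNorm (uncurry (v k)) ∞
      (volume.restrict (parabolicCylinder r ((1 : ℝ), (0 : EuclideanSpace ℝ (Fin 3))))))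
      atTop (𝓝 ∞))
    {glim : HomSobolev (EuclideanSpace ℝ (Fin 3)) (EuclideanSpace ℂ (Fin 3)) (1 / 2 : ℝ)}
    (hweak : ∀ w, Tendsto (fun n => ⟪g n, w⟫_ℂ) atTop (𝓝 ⟪glim, w⟫_ℂ))
    {vlim : EuclideanSpace ℝ (Fin 3) → EuclideanSpace ℝ (Fin 3)} (hv3 : MemLp vlim 3 volume)
    (hvrep : glim.Represents (complexify ∘ vlim)) (hvdiv : IsWeaklyDivFree vlim) :
    ¬ HasGlobalKatoSolution 1 vlim := by
  intro hglobal
  -- E: Leray solutions `w k ∈ NS(V k)`; W: they agree with the Kato solutions below `t = 1`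
  choose w q hw using fun k => leray_solution_exists_of_memLp_three_holds (V k) (hV k).1 (hV k).2.2
  have hae : ∀ k, uncurry (w k) =ᵐ[volume.restrict (Ioo 0 1 ×ˢ (univ : Set (EuclideanSpace ℝ (Fin 3))))]
      uncurry (v k) := fun k =>
    leray_solution_ae_eq_kato_holds (V k) (hV k).1 (hV k).2.2 (w k) (q k) (hw k) 1 (v k) (hv k)
  -- K: a subsequence in the situation of Prop. 2.2, with a Leray solution of the limit datum
  obtain ⟨ψ, hψ, ulim, plim, qq, hulim, hsit⟩ :=
    rusin_sverak_leray_weak_stability_holds V g w q hV hbdd hw glim hweak vlim hv3 hvrep hvdiv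
  -- W, R: the global Kato solution bounds `ulim` on `Q_{√(1/2)}(1, 0)`; B: `(1, 0)` is regular
  obtain ⟨wl, hwl⟩ := hglobal.exists_isKatoSolutionOn (1 + 1)
  have haelim : uncurry ulim =ᵐ[volume.restrict (Ioo 0 (1 + 1) ×ˢ (univ : Set (EuclideanSpace ℝ (Fin 3))))]
      uncurry wl :=
    leray_solution_ae_eq_kato_holds vlim hv3 hvdiv ulim plim hulim (1 + 1) wl hwl
  obtain ⟨C, hC⟩ :=
    kato_solution_le_div_sqrt_holds 1 (1 + 1) vlim wl one_pos hwl 1 one_pos (by norm_num)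
  have hρ : 0 < Real.sqrt (1 / 2) := Real.sqrt_pos.2 (by norm_num)
  have hρ1 : Real.sqrt (1 / 2) ^ 2 < 1 := by
    rw [Real.sq_sqrt (by norm_num)]
    norm_num
  have hlt := eLpNorm_parabolicCylinder_lt_top_of_sqrt_bound hρ1 le_rfl (by norm_num) haelim hC
    (0 : EuclideanSpace ℝ (Fin 3))
  have h1O : ((1 : ℝ), (0 : EuclideanSpace ℝ (Fin 3))) ∈
      (slab (EuclideanSpace ℝ (Fin 3)) (Ioi 0) isOpen_Ioi : Opens (ℝ × EuclideanSpace ℝ (Fin 3))) :=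
    mem_slab.2 (mem_Ioi.2 one_pos)
  have hreg : IsRegularPoint ulim ((1 : ℝ), (0 : EuclideanSpace ℝ (Fin 3))) :=
    isRegularPoint_of_eLpNorm_parabolicCylinder_lt_top_holds _ ulim plim hulim.suitable _ h1O
      (Real.sqrt (1 / 2)) hρ (parabolicCylinder_subset_slab_Ioi hρ1.le 0) hlt
  -- uniform regularity of the approximants near `(1, 0)`
  obtain ⟨ρ, hρpos, B, hev⟩ := hUR _ _ _ _ _ hsit _ h1O hreg
  set r₀ : ℝ := min ρ 1 with hr₀_def
  have hr₀ : 0 < r₀ := lt_min hρpos one_pos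
  have hr₀1 : r₀ ^ 2 ≤ 1 := by
    have h := min_le_right ρ 1
    nlinarith [hr₀.le]
  have hsub : parabolicCylinder r₀ ((1 : ℝ), (0 : EuclideanSpace ℝ (Fin 3))) ⊆
      parabolicCylinderCentered ρ ((1 : ℝ), (0 : EuclideanSpace ℝ (Fin 3))) := by
    refine Subset.trans ?_ (parabolicCylinder_subset_centered ρ _)
    have h2 : r₀ ^ 2 ≤ ρ ^ 2 := pow_le_pow_left₀ hr₀.le (min_le_left _ _) 2
    exact prod_mono (Ioo_subset_Ioo (by linarith) le_rfl) (ball_subset_ball (min_le_left _ _))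
  -- eventually `≤ B` on `Q_{r₀}(1, 0)` ...
  have hle : ∀ᶠ k in atTop, eLpNorm (uncurry (v (ψ k))) ∞
      (volume.restrict (parabolicCylinder r₀ ((1 : ℝ), (0 : EuclideanSpace ℝ (Fin 3))))) ≤ B := by
    filter_upwards [hev] with k hk
    rw [← concentrationWeakLimit_eLpNorm_congr_strip (hae (ψ k)) hr₀1 0]
    exact (eLpNorm_mono_measure _ (Measure.restrict_mono hsub le_rfl)).trans hk
  -- ... and eventually `> B` there (concentration along `ψ`)
  have hgt : ∀ᶠ k in atTop, (B : ℝ≥0∞) < eLpNorm (uncurry (v (ψ k))) ∞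
      (volume.restrict (parabolicCylinder r₀ ((1 : ℝ), (0 : EuclideanSpace ℝ (Fin 3))))) :=
    ((hconc r₀ hr₀).comp hψ.tendsto_atTop).eventually_const_lt ENNReal.coe_lt_top
  obtain ⟨k, hk1, hk2⟩ := (hle.and hgt).exists
  exact lt_irrefl _ (hk2.trans_le hk1)

/-! ## The stub -/

/-- **Stub `stub_concentrationWeakLimitBlowup` — weak limits of concentrating sequences blow up**
(concentration analogue of `rusin_sverak_weak_limit_blowup`; Rusin–Šverák 2011, Cor. 4.2 and
sentence 2 of the proof of Cor. 4.3). GIVEN the statement of `stub_uniformRegularity`: for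
`ν > 0`, weakly divergence-free `L³` data `U k` represented by `Ḣ^{1/2}`-bounded classes `G k`,
with Kato-class mild solutions `u k` on `[0, 1)` (viscosity `ν`) concentrating at `(1, x k)`, the
modulation `lam k = √ν`, `x₀ k = -x k` is such that every weak `Ḣ^{1/2}`-limit `glim` of a
subsequence of the classes of `y ↦ √ν U k (√ν y + x k)` is represented by an `L³`, weakly
divergence-free `v₀` with no global Kato solution. Proof: the weak limit is an `L³` real
divergence-free datum (`HomSobolev.exists_represents_memLp_three`,
`HomSobolev.Represents.exists_real_divFree`); the normalised fields
(`concentrationWeakLimit_kato_normalise`) are unit-viscosity Kato solutions on `[0, 1)` with data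
`ν⁻¹ •` (modulated data), represented by `ν⁻¹ • g'` (`represents_complexify_smul`, norms `≤ ν⁻¹ R` by
`exists_represents_rescaleData_norm_eq` and `Represents.unique`), concentrating at `(1, 0)`
(`concentrationWeakLimit_eLpNorm_normalise_ge`); the core gives `¬ HasGlobalKatoSolution 1 (ν⁻¹ • v₀)`,
i.e. `¬ HasGlobalKatoSolution ν v₀` (`hasGlobalKatoSolution_smul_iff`).
[cite: RusinSverak2011, Cor. 4.2 and proof of Cor. 4.3 (arXiv:0911.0500 p. 8)] -/
theorem stub_concentrationWeakLimitBlowup :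
    (∀ (O : TopologicalSpace.Opens (ℝ × EuclideanSpace ℝ (Fin 3))) (useq : ℕ → ℝ → EuclideanSpace ℝ (Fin 3) → EuclideanSpace ℝ (Fin 3)) (pseq : ℕ → ℝ → EuclideanSpace ℝ (Fin 3) → ℝ) (u : ℝ → EuclideanSpace ℝ (Fin 3) → EuclideanSpace ℝ (Fin 3)) (p : ℝ → EuclideanSpace ℝ (Fin 3) → ℝ), Literature.Analysis.FluidPDE.RusinSverak2011.CompactnessSituation O useq pseq u p → ∀ z₀ : ℝ × EuclideanSpace ℝ (Fin 3), z₀ ∈ O → Literature.Analysis.FluidPDE.IsRegularPoint u z₀ → ∃ ρ : ℝ, 0 < ρ ∧ ∃ B : NNReal, ∀ᶠ k : ℕ in Filter.atTop, MeasureTheory.eLpNorm (Function.uncurry (useq k)) ⊤ (MeasureTheory.volume.restrict (Literature.Analysis.FluidPDE.parabolicCylinderCentered ρ z₀)) ≤ (B : ENNReal)) →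
    ∀ ν : ℝ, 0 < ν → ∀ (U : ℕ → EuclideanSpace ℝ (Fin 3) → EuclideanSpace ℝ (Fin 3)) (G : ℕ → Literature.Analysis.FunctionSpaces.HomSobolev (EuclideanSpace ℝ (Fin 3)) (EuclideanSpace ℂ (Fin 3)) (1 / 2 : ℝ)) (u : ℕ → ℝ → EuclideanSpace ℝ (Fin 3) → EuclideanSpace ℝ (Fin 3)) (x : ℕ → EuclideanSpace ℝ (Fin 3)), (∀ k, MeasureTheory.MemLp (U k) 3 (MeasureTheory.volume : MeasureTheory.Measure (EuclideanSpace ℝ (Fin 3))) ∧ (G k).Represents (Literature.Analysis.FunctionSpaces.EuclideanSpace.complexify ∘ U k) ∧ Literature.Analysis.FluidPDE.IsWeaklyDivFree (U k)) → (∃ R : ℝ, ∀ k, ‖G k‖ ≤ R) → (∀ k, Literature.Analysis.FluidPDE.IsMildNSSolutionOn (Set.Ico 0 1) ν 0 (U k) (u k) ∧ Literature.Analysis.FluidPDE.ContinuousInLpOn (Set.Ico 0 1) 3 (u k) ∧ u k 0 = U k ∧ MeasureTheory.AEStronglyMeasurable (Function.uncurry (u k)) (MeasureTheory.volume.restrict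 (Set.Ioo (0 : ℝ) 1 ×ˢ (Set.univ : Set (EuclideanSpace ℝ (Fin 3)))))) → (∀ r : ℝ, 0 < r → Filter.Tendsto (fun k => MeasureTheory.eLpNorm (Function.uncurry (u k)) ⊤ (MeasureTheory.volume.restrict (Literature.Analysis.FluidPDE.parabolicCylinder r ((1 : ℝ), x k)))) Filter.atTop (nhds ⊤)) → ∃ (lam : ℕ → ℝ) (x₀ : ℕ → EuclideanSpace ℝ (Fin 3)), (∀ k, 0 < lam k) ∧ ∀ g' : ℕ → Literature.Analysis.FunctionSpaces.HomSobolev (EuclideanSpace ℝ (Fin 3)) (EuclideanSpace ℂ (Fin 3)) (1 / 2 : ℝ), (∀ k, (g' k).Represents (Literature.Analysis.FunctionSpaces.EuclideanSpace.complexify ∘ Literature.Analysis.FluidPDE.rescaleData (lam k) (fun y => U k (y - x₀ k)))) → ∀ φ : ℕ → ℕ, StrictMono φ → ∀ glim : Literature.Analysis.FunctionSpaces.HomSobolev (EuclideanSpace ℝ (Fin 3)) (EuclideanSpace ℂ (Fin 3)) (1 / 2 : ℝ), (∀ w, Filter.Tendsto (fun n => inner ℂ (g' (φ n)) w) Filter.atTop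 (nhds (inner ℂ glim w))) → ∃ v₀ : EuclideanSpace ℝ (Fin 3) → EuclideanSpace ℝ (Fin 3), MeasureTheory.MemLp v₀ 3 (MeasureTheory.volume : MeasureTheory.Measure (EuclideanSpace ℝ (Fin 3))) ∧ glim.Represents (Literature.Analysis.FunctionSpaces.EuclideanSpace.complexify ∘ v₀) ∧ Literature.Analysis.FluidPDE.IsWeaklyDivFree v₀ ∧ ¬ Literature.Analysis.FluidPDE.HasGlobalKatoSolution ν v₀ := by
  intro hUR ν hν U G u x hdata hbdd hkato hconc
  have hc : 0 < Real.sqrt ν := Real.sqrt_pos.2 hν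
  have ha : 0 < ν⁻¹ := inv_pos.2 hν
  refine ⟨fun _ => Real.sqrt ν, fun k => -x k, fun _ => hc, ?_⟩
  intro g' hg' φ hφ glim hweak
  -- the modulated classes have the norms of the `G k`
  obtain ⟨R, hR⟩ := hbdd
  have hg'norm : ∀ k, ‖g' k‖ ≤ R := fun k => by
    obtain ⟨g'', hg''rep, hg''norm⟩ :=
      exists_represents_rescaleData_norm_eq (U k) (G k) hc (-x k) (hdata k).2.1
    rw [(hg' k).unique hg''rep, hg''norm]
    exact hR k
  -- the modulated data are weakly divergence-free `L³` fields
  have hmod : ∀ k, MemLp (rescaleData (Real.sqrt ν) fun y => U k (y - -x k)) 3 volume ∧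
      IsWeaklyDivFree (rescaleData (Real.sqrt ν) fun y => U k (y - -x k)) := fun k =>
    ⟨memLp_three_rescaleData
      ((hdata k).1.comp_measurePreserving (measurePreserving_sub_right volume (-x k))) hc,
     ((hdata k).2.2.comp_sub_right (-x k)).nsRescaleData hc⟩
  -- the weak limit is an `L³`, real, divergence-free datum
  obtain ⟨f, hf3, hfrep⟩ := HomSobolev.exists_represents_memLp_three
    eLpNorm_three_le_eHomSobolevSeminorm_half_holds glim
  obtain ⟨v₀, hv3, hvrep, hvdiv, -⟩ := HomSobolev.Represents.exists_real_divFree hweak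
    (u := fun n => rescaleData (Real.sqrt ν) fun y => U (φ n) (y - -x (φ n)))
    (fun n => hg' (φ n)) (fun n => (hmod (φ n)).1.locallyIntegrable (by norm_num))
    (fun n => (hmod (φ n)).2) hfrep hf3
  refine ⟨v₀, hv3, hvrep, hvdiv, fun hglobal => ?_⟩
  -- reduction to unit viscosity: `ν⁻¹ • v₀` would have a global unit-viscosity Kato solution
  have hglobal1 : HasGlobalKatoSolution 1 (ν⁻¹ • v₀) := by
    have h1 := (hasGlobalKatoSolution_smul_iff (u₀ := v₀) ha).2 hglobal
    rwa [inv_mul_cancel₀ hν.ne'] at h1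
  -- the normalised, rescaled sequence along `φ` concentrates at `(1, 0)`
  have hCne : (‖Real.sqrt ν‖ₑ * ‖ν⁻¹‖ₑ : ℝ≥0∞) ≠ 0 :=
    mul_ne_zero (by simpa using hc.ne') (by simpa using ha.ne')
  have hCtop : (‖Real.sqrt ν‖ₑ * ‖ν⁻¹‖ₑ : ℝ≥0∞) ≠ ∞ := ENNReal.mul_ne_top enorm_ne_top enorm_ne_top
  have hconc1 : ∀ r : ℝ, 0 < r → Tendsto (fun n => eLpNorm (uncurry fun t y => Real.sqrt ν •
      timeRescale ν⁻¹ ν⁻¹ (u (φ n)) (Real.sqrt ν ^ 2 * t) (Real.sqrt ν • y - -x (φ n))) ∞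
      (volume.restrict (parabolicCylinder r ((1 : ℝ), (0 : EuclideanSpace ℝ (Fin 3))))))
      atTop (𝓝 ∞) := by
    intro r hr
    have hr' : 0 < min r (Real.sqrt ν * r) := lt_min hr (mul_pos hc hr)
    have h1 := ENNReal.Tendsto.const_mul (a := ‖Real.sqrt ν‖ₑ * ‖ν⁻¹‖ₑ)
      ((hconc _ hr').comp hφ.tendsto_atTop) (Or.inr hCtop)
    rw [ENNReal.mul_top hCne] at h1
    exact tendsto_nhds_top_mono h1 (Eventually.of_forall fun n =>
      concentrationWeakLimit_eLpNorm_normalise_ge hν (u (φ n)) (x (φ n)) hr)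
  -- the core at unit viscosity, for the scaled classes `ν⁻¹ • g' (φ n) ⇀ ν⁻¹ • glim`
  exact concentrationWeakLimit_not_hasGlobalKatoSolution_one hUR
    (V := fun n => ν⁻¹ • rescaleData (Real.sqrt ν) fun y => U (φ n) (y - -x (φ n)))
    (g := fun n => ((ν⁻¹ : ℝ) : ℂ) • g' (φ n))
    (fun n => ⟨(hmod (φ n)).1.const_smul _, represents_complexify_smul (hg' (φ n)) ν⁻¹,
      (hmod (φ n)).2.const_smul ν⁻¹⟩)
    ⟨ν⁻¹ * R, fun n => by
      rw [norm_smul, Complex.norm_real, Real.norm_of_nonneg ha.le]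
      exact mul_le_mul_of_nonneg_left (hg'norm (φ n)) ha.le⟩
    (fun n => concentrationWeakLimit_kato_normalise hν (hkato (φ n)) (x (φ n))) hconc1
    (glim := ((ν⁻¹ : ℝ) : ℂ) • glim)
    (fun w' => by simpa only [inner_smul_left] using (hweak w').const_mul _)
    (hv3.const_smul _) (represents_complexify_smul hvrep ν⁻¹) (hvdiv.const_smul ν⁻¹) hglobal1

end Summit.NavierStokesRegularity.NavierStokesRegularity.Theorems

end
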